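import Summits.CriticalPhenomena.PercolationContinuityZ3.Theorems.PercNearOneGluingNoHeavyLowerTailGeneralTerminalSeparation
import HarnessLib

/-!
# `NoHeavyLowerTail` (stmt-CriticalPhenomena-4575) — terminal separation for "`a` reaches SOME vertex of `O`",
# with a decreasing pair-separation guard inside the cluster event

Seat `prim-gen-swap`, 2026-08-18.  With `μ = prodBernoulli w` on `Fin n`, a vertex `a`, finite vertex sets `T, O`, and two finite
sets of pairs `P₁, P₂` each starting in `T`, put
`E = {∃ v ∈ O, a ↔ v}` (increasing, determined by the cluster of `a`), `D = {a ↮ T}`,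
`Qᵢ = {t ↮ u ∀ (t,u) ∈ Pᵢ}` (decreasing, determined by the clusters of `T`).  Then

  `μ(E ∩ D ∩ Q₁) · μ(D ∩ Q₂) ≤ μ(D) · μ(E ∩ D ∩ Q₁ ∩ Q₂)`            (`terminalSeparation_some_guarded`)

i.e. given `a ↮ T`, the event "`a` reaches `O` AND the guard `Q₁` holds" is positively correlated with `Q₂`.  Mechanism as in the
tree's `terminalSeparation_general` (Kozma–Nitzan Lemma 1(i) / BHK 2006 Thm 1.3): condition on `C(a) = K`; off `K` the configuration
is fresh, so the conditional probabilities of `E ∩ Q₁` and of `Q₂` are `1[O ∩ K ≠ ∅] · μ(Q₁ off K)` and `μ(Q₂ off K)`, both increasing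
functions of the edge cluster; Harris (two decreasing events, `prodBernoulli_harris_lower`) bounds their product by the conditional
probability of `E ∩ Q₁ ∩ Q₂`, and BHK Thm 1.3 (`BHK2006_clusterConditionalPositiveAssociation_holds`) integrates.  This is the row used in
the level-1 case of champion stability (`stub_championStabilityPair`, report MERGE-STABILITY.md): `O = {o, v}`, `P₁ = {(t,o),(t,v)}`,
`P₂` = pairwise separation of the other relays.
-/

namespace Summit.CriticalPhenomena.PercolationContinuityZ3.Theorems

open scoped BigOperators Classical
open MeasureTheory Set
open Literature.Probability.LatticeModels (prodBernoulli prodBernoulli_real_inter_of_determinedBy prodBernoulli_harris_lower)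
open Literature.Probability.Percolation
open GeneralTerminalSeparation

variable {n : ℕ}

namespace GuardedSomeTS

/-- The increasing function `F_O^∃(W) = 1{some v ∈ O is a or lies on an edge of W}`. [folklore] -/
theorem monotone_Fsome (a : Fin n) (O : Finset (Fin n)) :
    Monotone fun W : Set (Sym2 (Fin n)) =>
      (if ∃ v ∈ O, v = a ∨ ∃ e ∈ W, v ∈ e then (1 : ℝ) else 0) := by
  intro W W' h
  simp only
  by_cases hW : ∃ v ∈ O, v = a ∨ ∃ e ∈ W, v ∈ e
  · obtain ⟨v, hv, hv'⟩ := hW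
    rw [if_pos ⟨v, hv, hv'⟩, if_pos ⟨v, hv, hv'.imp id fun ⟨e, he, hve⟩ => ⟨e, h he, hve⟩⟩]
  · rw [if_neg hW]; split_ifs <;> norm_num

/-- On `{C(a) = K}`, `F_O^∃(C_a ω) = [O ∩ K ≠ ∅]`. [folklore] -/
theorem Fsome_openEdgeCluster {a : Fin n} (O : Finset (Fin n)) {K : Finset (Fin n)}
    {ω : BondConfig (Fin n)} (hω : ω ∈ clusterIs a K) :
    (if ∃ v ∈ O, v = a ∨ ∃ e ∈ openEdgeCluster ω a, v ∈ e then (1 : ℝ) else 0) =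
      if ∃ v ∈ O, v ∈ K then 1 else 0 := by
  have key : (∃ v ∈ O, v = a ∨ ∃ e ∈ openEdgeCluster ω a, v ∈ e) ↔ ∃ v ∈ O, v ∈ K := by
    refine exists_congr fun v => and_congr_right fun _ => ?_
    rw [← reachable_iff_exists_mem_openEdgeCluster ω a v]
    exact mem_openConn_iff_of_mem' hω
  simp only [key]

/-- `E^∃_O ∩ S ∩ {C(a) = K}` is `S ∩ {C(a) = K}` if `O` meets `K`, and empty otherwise. [folklore] -/
theorem connSome_inter_inter_clusterIs (a : Fin n) (O K : Finset (Fin n))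
    (S : Set (BondConfig (Fin n))) :
    {ω | ∃ v ∈ O, ω ∈ openConn a v} ∩ (S ∩ clusterIs a K) =
      if (∃ v ∈ O, v ∈ K) then S ∩ clusterIs a K else ∅ := by
  ext ω
  split_ifs with ho
  · refine ⟨fun h => h.2, fun h => ⟨?_, h⟩⟩
    obtain ⟨v, hv, hvK⟩ := ho
    exact ⟨v, hv, (mem_openConn_iff_of_mem' h.2).2 hvK⟩
  · simp only [mem_inter_iff, mem_setOf_eq, mem_empty_iff_false, iff_false, not_and]
    exact fun ⟨v, hv, hE⟩ _ hω => ho ⟨v, hv, (mem_openConn_iff_of_mem' hω).1 hE⟩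

/-- "`Q` holds using only the edges avoiding `K`" is a decreasing event when `Q` is. [folklore] -/
theorem isLowerSet_sepOff {Q : Set (BondConfig (Fin n))} (hQ : IsLowerSet Q) (K : Set (Fin n)) :
    IsLowerSet {ω : BondConfig (Fin n) | ω \ edgesTouching K ∈ Q} :=
  fun _ _ hle hω => hQ (sdiff_le_sdiff_right hle) hω

/-- The product `F_O^∃ · G_{Q}` is increasing (both factors are increasing and nonnegative). [folklore] -/
theorem monotone_Fsome_mul_G (w : Sym2 (Fin n) → unitInterval) {Q : Set (BondConfig (Fin n))}
    (hQ : IsLowerSet Q) (a : Fin n) (O : Finset (Fin n)) :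
    Monotone fun W : Set (Sym2 (Fin n)) =>
      (if ∃ v ∈ O, v = a ∨ ∃ e ∈ W, v ∈ e then (1 : ℝ) else 0) *
        (prodBernoulli w).real {ω | ω \ edgesTouching {v | v = a ∨ ∃ e ∈ W, v ∈ e} ∈ Q} := by
  intro W W' h
  have h1 := monotone_Fsome a O h
  have h2 := monotone_G' w hQ a h
  simp only at h1 h2 ⊢
  refine mul_le_mul h1 h2 measureReal_nonneg ?_
  split_ifs <;> norm_num

variable (w : Sym2 (Fin n) → unitInterval) (T O : Finset (Fin n)) (a : Fin n)
  {Q₁ Q₂ : Set (BondConfig (Fin n))}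

/-- `∫_{a ↮ T} F^∃_O(C_a) G_{Q₁}(C_a) dμ = μ(E^∃ ∩ ({a ↮ T} ∩ Q₁))`. [folklore] -/
theorem setIntegral_Fsome_mul_G
    (hQ : ∀ (K : Finset (Fin n)) (ω : BondConfig (Fin n)), ω ∈ clusterIs a K →
      (∀ t ∈ T, t ∉ K) → (ω ∈ Q₁ ↔ ω \ edgesTouching (↑K : Set (Fin n)) ∈ Q₁)) :
    ∫ ω in {ω | ∀ t ∈ T, ω ∉ openConn a t},
        (if ∃ v ∈ O, v = a ∨ ∃ e ∈ openEdgeCluster ω a, v ∈ e then (1 : ℝ) else 0) *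
          (prodBernoulli w).real
            {ω' | ω' \ edgesTouching {v | v = a ∨ ∃ e ∈ openEdgeCluster ω a, v ∈ e} ∈ Q₁}
        ∂(prodBernoulli w) =
      (prodBernoulli w).real ({ω | ∃ v ∈ O, ω ∈ openConn a v} ∩
        ({ω | ∀ t ∈ T, ω ∉ openConn a t} ∩ Q₁)) := by
  rw [setIntegral_eq_sum_clusterIs' (prodBernoulli w) a {ω | ∀ t ∈ T, ω ∉ openConn a t} _
      (fun K => (if (∃ v ∈ O, v ∈ K) then (1 : ℝ) else 0) *
        (prodBernoulli w).real {ω' | ω' \ edgesTouching (↑K : Set (Fin n)) ∈ Q₁})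
      (fun K ω hω => by rw [Fsome_openEdgeCluster O hω, G_openEdgeCluster' w Q₁ hω]),
    measureReal_eq_sum_clusterIs' (prodBernoulli w) a
      ({ω | ∃ v ∈ O, ω ∈ openConn a v} ∩ ({ω | ∀ t ∈ T, ω ∉ openConn a t} ∩ Q₁))]
  refine Finset.sum_congr rfl fun K _ => ?_
  rw [inter_assoc, connSome_inter_inter_clusterIs]
  split_ifs with ho
  · rw [one_mul, real_disconn_inter_clusterIs_mul' w T a hQ]
  · simp

/-- Termwise Harris step: on `{C(a) = K}`,
`μ({a ↮ T} ∩ {C = K}) μ(Q₁ off K) μ(Q₂ off K) ≤ μ({a ↮ T} ∩ (Q₁ ∩ Q₂) ∩ {C = K})`. [folklore] -/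
theorem real_disconn_inter_clusterIs_mul_mul_le (hQ₁l : IsLowerSet Q₁) (hQ₂l : IsLowerSet Q₂)
    (hQ : ∀ (K : Finset (Fin n)) (ω : BondConfig (Fin n)), ω ∈ clusterIs a K →
      (∀ t ∈ T, t ∉ K) → (ω ∈ Q₁ ∩ Q₂ ↔ ω \ edgesTouching (↑K : Set (Fin n)) ∈ Q₁ ∩ Q₂))
    (K : Finset (Fin n)) :
    (prodBernoulli w).real ({ω | ∀ t ∈ T, ω ∉ openConn a t} ∩ clusterIs a K) *
        (prodBernoulli w).real {ω | ω \ edgesTouching (↑K : Set (Fin n)) ∈ Q₁} *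
        (prodBernoulli w).real {ω | ω \ edgesTouching (↑K : Set (Fin n)) ∈ Q₂} ≤
      (prodBernoulli w).real ({ω | ∀ t ∈ T, ω ∉ openConn a t} ∩ (Q₁ ∩ Q₂) ∩ clusterIs a K) := by
  have hH : (prodBernoulli w).real {ω | ω \ edgesTouching (↑K : Set (Fin n)) ∈ Q₁} *
      (prodBernoulli w).real {ω | ω \ edgesTouching (↑K : Set (Fin n)) ∈ Q₂} ≤
      (prodBernoulli w).real ({ω | ω \ edgesTouching (↑K : Set (Fin n)) ∈ Q₁} ∩
        {ω | ω \ edgesTouching (↑K : Set (Fin n)) ∈ Q₂}) :=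
    prodBernoulli_harris_lower w (isLowerSet_sepOff hQ₁l ↑K) (isLowerSet_sepOff hQ₂l ↑K)
      MeasurableSet.of_discrete MeasurableSet.of_discrete
  have heq : {ω : BondConfig (Fin n) | ω \ edgesTouching (↑K : Set (Fin n)) ∈ Q₁} ∩
      {ω | ω \ edgesTouching (↑K : Set (Fin n)) ∈ Q₂} =
      {ω | ω \ edgesTouching (↑K : Set (Fin n)) ∈ Q₁ ∩ Q₂} := by
    ext ω; simp only [mem_inter_iff, mem_setOf_eq]
  rw [heq] at hH
  rw [mul_assoc, ← real_disconn_inter_clusterIs_mul' w T a hQ K]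
  exact mul_le_mul_of_nonneg_left hH measureReal_nonneg

/-- `∫_{a ↮ T} F^∃_O G_{Q₁} G_{Q₂} dμ ≤ μ(E^∃ ∩ ({a ↮ T} ∩ (Q₁ ∩ Q₂)))`. [folklore] -/
theorem setIntegral_Fsome_mul_G_mul_G_le (hQ₁l : IsLowerSet Q₁) (hQ₂l : IsLowerSet Q₂)
    (hQ : ∀ (K : Finset (Fin n)) (ω : BondConfig (Fin n)), ω ∈ clusterIs a K →
      (∀ t ∈ T, t ∉ K) → (ω ∈ Q₁ ∩ Q₂ ↔ ω \ edgesTouching (↑K : Set (Fin n)) ∈ Q₁ ∩ Q₂)) :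
    ∫ ω in {ω | ∀ t ∈ T, ω ∉ openConn a t},
        ((if ∃ v ∈ O, v = a ∨ ∃ e ∈ openEdgeCluster ω a, v ∈ e then (1 : ℝ) else 0) *
          (prodBernoulli w).real
            {ω' | ω' \ edgesTouching {v | v = a ∨ ∃ e ∈ openEdgeCluster ω a, v ∈ e} ∈ Q₁}) *
          (prodBernoulli w).real
            {ω' | ω' \ edgesTouching {v | v = a ∨ ∃ e ∈ openEdgeCluster ω a, v ∈ e} ∈ Q₂}
        ∂(prodBernoulli w) ≤
      (prodBernoulli w).real ({ω | ∃ v ∈ O, ω ∈ openConn a v} ∩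
        ({ω | ∀ t ∈ T, ω ∉ openConn a t} ∩ (Q₁ ∩ Q₂))) := by
  rw [setIntegral_eq_sum_clusterIs' (prodBernoulli w) a {ω | ∀ t ∈ T, ω ∉ openConn a t} _
      (fun K => ((if (∃ v ∈ O, v ∈ K) then (1 : ℝ) else 0) *
        (prodBernoulli w).real {ω' | ω' \ edgesTouching (↑K : Set (Fin n)) ∈ Q₁}) *
        (prodBernoulli w).real {ω' | ω' \ edgesTouching (↑K : Set (Fin n)) ∈ Q₂})
      (fun K ω hω => by
        rw [Fsome_openEdgeCluster O hω, G_openEdgeCluster' w Q₁ hω, G_openEdgeCluster' w Q₂ hω]),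
    measureReal_eq_sum_clusterIs' (prodBernoulli w) a
      ({ω | ∃ v ∈ O, ω ∈ openConn a v} ∩ ({ω | ∀ t ∈ T, ω ∉ openConn a t} ∩ (Q₁ ∩ Q₂)))]
  refine Finset.sum_le_sum fun K _ => ?_
  rw [inter_assoc, connSome_inter_inter_clusterIs]
  split_ifs with ho
  · rw [one_mul, ← mul_assoc]
    exact real_disconn_inter_clusterIs_mul_mul_le w T a hQ₁l hQ₂l hQ K
  · simp

end GuardedSomeTS

open GuardedSomeTS in
/-- **Guarded terminal separation for "`a` reaches some vertex of `O`".**  For `μ = prodBernoulli w` on `Fin n`, a vertex `a`,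
vertex sets `T, O`, and finite sets of pairs `P₁, P₂` each starting in `T`: with `E = {∃ v ∈ O, a ↔ v}`, `D = {a ↮ T}`,
`Qᵢ = {t ↮ u ∀ (t,u) ∈ Pᵢ}`:  `μ(E ∩ D ∩ Q₁) · μ(D ∩ Q₂) ≤ μ(D) · μ(E ∩ (D ∩ (Q₁ ∩ Q₂)))`.
[cite: KozmaNitzan2024, Lemma 1(i) (p. 5); VandenbergHaggstromKahn2005, Thm. 1.3] -/
theorem terminalSeparation_some_guarded (w : Sym2 (Fin n) → unitInterval) (T O : Finset (Fin n))
    (a : Fin n) (P₁ P₂ : Finset (Fin n × Fin n)) (hP₁ : ∀ p ∈ P₁, p.1 ∈ T) (hP₂ : ∀ p ∈ P₂, p.1 ∈ T) :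
    (prodBernoulli w).real ({ω | ∃ v ∈ O, ω ∈ openConn a v} ∩ ({ω | ∀ t ∈ T, ω ∉ openConn a t} ∩
          {ω | ∀ p ∈ P₁, ω ∉ openConn p.1 p.2})) *
        (prodBernoulli w).real ({ω | ∀ t ∈ T, ω ∉ openConn a t} ∩
          {ω | ∀ p ∈ P₂, ω ∉ openConn p.1 p.2}) ≤
      (prodBernoulli w).real {ω | ∀ t ∈ T, ω ∉ openConn a t} *
        (prodBernoulli w).real ({ω | ∃ v ∈ O, ω ∈ openConn a v} ∩
          ({ω | ∀ t ∈ T, ω ∉ openConn a t} ∩ ({ω | ∀ p ∈ P₁, ω ∉ openConn p.1 p.2} ∩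
            {ω | ∀ p ∈ P₂, ω ∉ openConn p.1 p.2}))) := by
  by_cases haT : a ∈ T
  · have hD : {ω : BondConfig (Fin n) | ∀ t ∈ T, ω ∉ openConn a t} = ∅ :=
      Set.subset_empty_iff.1 fun ω hω => hω a haT (SimpleGraph.Reachable.refl a)
    simp [hD]
  · set Q₁ : Set (BondConfig (Fin n)) := {ω | ∀ p ∈ P₁, ω ∉ openConn p.1 p.2} with hQ₁def
    set Q₂ : Set (BondConfig (Fin n)) := {ω | ∀ p ∈ P₂, ω ∉ openConn p.1 p.2} with hQ₂def
    have hQ₁ : ∀ (K : Finset (Fin n)) (ω : BondConfig (Fin n)), ω ∈ clusterIs a K →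
        (∀ t ∈ T, t ∉ K) → (ω ∈ Q₁ ↔ ω \ edgesTouching (↑K : Set (Fin n)) ∈ Q₁) :=
      fun K ω hω hTK => pairSep_iff_off_of_mem' hP₁ hω hTK
    have hQ₂ : ∀ (K : Finset (Fin n)) (ω : BondConfig (Fin n)), ω ∈ clusterIs a K →
        (∀ t ∈ T, t ∉ K) → (ω ∈ Q₂ ↔ ω \ edgesTouching (↑K : Set (Fin n)) ∈ Q₂) :=
      fun K ω hω hTK => pairSep_iff_off_of_mem' hP₂ hω hTK
    have hP₁₂ : ∀ p ∈ P₁ ∪ P₂, p.1 ∈ T := fun p hp =>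
      (Finset.mem_union.1 hp).elim (hP₁ p) (hP₂ p)
    have hQ₁₂eq : Q₁ ∩ Q₂ = {ω : BondConfig (Fin n) | ∀ p ∈ P₁ ∪ P₂, ω ∉ openConn p.1 p.2} := by
      ext ω
      simp only [hQ₁def, hQ₂def, mem_inter_iff, mem_setOf_eq, Finset.mem_union]
      exact ⟨fun ⟨h1, h2⟩ p hp => hp.elim (h1 p) (h2 p), fun h => ⟨fun p hp => h p (Or.inl hp),
        fun p hp => h p (Or.inr hp)⟩⟩
    have hQ₁₂ : ∀ (K : Finset (Fin n)) (ω : BondConfig (Fin n)), ω ∈ clusterIs a K →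
        (∀ t ∈ T, t ∉ K) → (ω ∈ Q₁ ∩ Q₂ ↔ ω \ edgesTouching (↑K : Set (Fin n)) ∈ Q₁ ∩ Q₂) := by
      intro K ω hω hTK
      rw [hQ₁₂eq]
      exact pairSep_iff_off_of_mem' hP₁₂ hω hTK
    have hR : {ω : BondConfig (Fin n) | ∀ x ∈ (↑T : Set (Fin n)), ¬ (openGraph ω).Reachable a x} =
        {ω | ∀ t ∈ T, ω ∉ openConn a t} := by
      ext ω; simp only [mem_setOf_eq, Finset.mem_coe]; rfl
    have key := BHK2006_clusterConditionalPositiveAssociation_holds (Fin n) w a (↑T : Set (Fin n))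
      (fun W => (if ∃ v ∈ O, v = a ∨ ∃ e ∈ W, v ∈ e then (1 : ℝ) else 0) *
        (prodBernoulli w).real {ω | ω \ edgesTouching {v | v = a ∨ ∃ e ∈ W, v ∈ e} ∈ Q₁})
      (fun W => (prodBernoulli w).real {ω | ω \ edgesTouching {v | v = a ∨ ∃ e ∈ W, v ∈ e} ∈ Q₂})
      (monotone_Fsome_mul_G w (isLowerSet_pairSep P₁) a O) (monotone_G' w (isLowerSet_pairSep P₂) a)
      (fun h => haT (Finset.mem_coe.1 h))
    rw [hR, setIntegral_Fsome_mul_G w T O a hQ₁, setIntegral_G' w T a hQ₂] at key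
    refine key.trans (mul_le_mul_of_nonneg_left ?_ measureReal_nonneg)
    exact setIntegral_Fsome_mul_G_mul_G_le w T O a (isLowerSet_pairSep P₁) (isLowerSet_pairSep P₂) hQ₁₂

end Summit.CriticalPhenomena.PercolationContinuityZ3.Theorems
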